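import Summits.Parity.GeneralizedHardyLittlewood.Theorems.Dhl42Tame

/-!
# DHL[42,2] certificate — marginals `F₁`, `F_m`, the left side `varLHS` of (4.3), indicators

§2 `marg F (t') = ∫ F(s, t') ds`, `margAt m F`, `varLHS F G = Σ_m (2⟨F_m, G_m⟩ − ⟨G_m, G_m⟩)` (the
left side of the variational hypothesis (4.3) of Theorem 4.3), `margAt_eq_marg_of_symm` (a symmetric
function has all marginals equal), and `Tame.marg` (the marginal of a tame function on `S·R_{n+1}`
is tame on `S·R_n`); §3 the real-valued indicator `ind s` and boundedness bookkeeping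
(`bdd_mul/sq/abs/comp`). `varLHS`, `marg`, `margAt` are referenced by the statement of Theorem 4.3
at the instance (`Dhl42Theorem43`).

Origin: `Dhl42/CertificateInequality.lean` of the DHL[42,2] certificate package (pub-dhl42 bundle,
archive blob `18cce9e3`; sha256[:16] of the file `ba7c9b2361ca6afe`; paper snapshot =
`paper/main.tex` v1), lines :269–:406; statements and proofs unchanged except: namespace `TpY4Dhl42`
→ `Summit.Parity.GeneralizedHardyLittlewood.Theorems.Dhl42`, the package's `simplexSet n B` replaced
by the tree's definitionally equal `Literature.NumberTheory.Sieve.scaledSimplex n B` (also inside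
declaration names), docstrings added where missing, `#print axioms` lines dropped;
`unfold TpY4Dhl42.marg` (:334) → `unfold Dhl42.marg`. Package-internal references in the verbatim
docstrings (`Dhl42/….lean`, `Assumed.…`, `row 9…`, `gen n`, `inputs/COMPARE.md`) refer to that
package (paper Appendix B).

Declarations (26): `marg`, `margAt`, `margAt_zero`, `varLHS`, `margAt_eq_marg_of_symm`,
`Tame.cons_eq_zero`, `Tame.cons_left`, `Tame.integrable_cons_left`, `Tame.marg_eq_setIntegral`,
`Tame.marg`, `ind`, `ind_of_mem`, `ind_of_notMem`, `ind_eq_zero_or_one`, `ind_nonneg`,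
`abs_ind_le_one`, `bdd_ind`, `ind_congr`, `ind_mul_ind`, `measurable_ind`, `ind_eq_indicator`,
`integral_ind`, `bdd_mul`, `bdd_sq`, `bdd_abs`, `bdd_comp`.
-/

open MeasureTheory Set Filter
open Literature.NumberTheory.Sieve (scaledSimplex)

namespace Summit.Parity.GeneralizedHardyLittlewood.Theorems.Dhl42

noncomputable section

/-! ### §2. Marginals and the variational left-hand side -/

section Marginals

variable {n : ℕ}

/-- The first-coordinate marginal `F₁(t') = ∫ F(s, t') ds`. -/
def marg (F : (Fin (n + 1) → ℝ) → ℝ) (t' : Fin n → ℝ) : ℝ := ∫ s, F (Fin.cons s t')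

/-- The marginal in coordinate `m`: `F_m(t') = ∫ F(t) dt_m` with `t^{(m)} = t'`. -/
def margAt (m : Fin (n + 1)) (F : (Fin (n + 1) → ℝ) → ℝ) (t' : Fin n → ℝ) : ℝ :=
  ∫ s, F (Fin.insertNth m s t')

/-- The marginal at place `0` is the first marginal: `margAt 0 F = marg F`. -/
theorem margAt_zero (F : (Fin (n + 1) → ℝ) → ℝ) : margAt 0 F = marg F := by
  funext t'
  simp only [margAt, marg, Fin.insertNth_zero']

/-- The left-hand side of the variational hypothesis (4.3) of Theorem 4.3 (`thm:A`, `eq:varhyp`):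
`Σ_{m} (2⟨F_m, G_m⟩ − ⟨G_m, G_m⟩)`, inner products in `L²(ℝ^{k−1})`. -/
def varLHS (F : (Fin (n + 1) → ℝ) → ℝ) (G : Fin (n + 1) → (Fin n → ℝ) → ℝ) : ℝ :=
  ∑ m, (2 * (∫ t', margAt m F t' * G m t') - ∫ t', G m t' ^ 2)

/-- A function symmetric under all coordinate permutations has all its marginals equal. -/
theorem margAt_eq_marg_of_symm {F : (Fin (n + 1) → ℝ) → ℝ}
    (hF : ∀ (σ : Equiv.Perm (Fin (n + 1))) (t : Fin (n + 1) → ℝ), F (t ∘ ⇑σ) = F t)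
    (m : Fin (n + 1)) : margAt m F = marg F := by
  funext t'
  simp only [margAt, marg]
  congr 1
  funext s
  rw [insertNth_eq_cons_comp_cycleRange, hF]

variable {S : ℝ} {Fi : (Fin (n + 1) → ℝ) → ℝ}

/-- A function tame on `S·R_{n+1}` vanishes at `(s, t')` when `s ∉ [0, S]`. -/
theorem Tame.cons_eq_zero (h : Tame (scaledSimplex (n + 1) S) Fi) {s : ℝ} {t' : Fin n → ℝ}
    (hs : s ∉ Icc 0 S) : Fi (Fin.cons s t') = 0 :=
  h.eq_zero _ fun hm => hs (mem_Icc_of_cons_mem_scaledSimplex' hm)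

/-- Every section `s ↦ F(s, t')` of a function tame on `S·R_{n+1}` is tame on `[0, S]`. -/
theorem Tame.cons_left (h : Tame (scaledSimplex (n + 1) S) Fi) (t' : Fin n → ℝ) :
    Tame (Icc 0 S) fun s : ℝ => Fi (Fin.cons s t') := by
  obtain ⟨C, hC0, hC⟩ := h.bdd
  exact ⟨h.measurable.comp (continuous_cons_left t').measurable, ⟨C, hC0, fun s => hC _⟩,
    fun s hs => h.cons_eq_zero hs⟩

/-- Every section `s ↦ F(s, t')` of a function tame on `S·R_{n+1}` is integrable on `ℝ`. -/
theorem Tame.integrable_cons_left (h : Tame (scaledSimplex (n + 1) S) Fi) (t' : Fin n → ℝ) :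
    Integrable fun s : ℝ => Fi (Fin.cons s t') :=
  (h.cons_left t').integrable measure_Icc_lt_top.ne

/-- For `F` tame on `S·R_{n+1}` the marginal is a set integral: `F₁(t') = ∫_{[0,S]} F(s, t') ds`. -/
theorem Tame.marg_eq_setIntegral (h : Tame (scaledSimplex (n + 1) S) Fi) (t' : Fin n → ℝ) :
    marg Fi t' = ∫ s in Icc 0 S, Fi (Fin.cons s t') := by
  unfold marg
  rw [setIntegral_eq_integral_of_forall_compl_eq_zero fun s hs => h.cons_eq_zero hs]

/-- The marginal of a tame function on `S·R_{n+1}` is tame on `S·R_n`. -/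
theorem Tame.marg (h : Tame (scaledSimplex (n + 1) S) Fi) : Tame (scaledSimplex n S) (marg Fi) := by
  obtain ⟨C, hC0, hC⟩ := h.bdd
  refine ⟨?_, ⟨C * volume.real (Icc (0 : ℝ) S), mul_nonneg hC0 measureReal_nonneg, fun t' => ?_⟩,
    fun t' ht' => ?_⟩
  · have hsm : StronglyMeasurable
        (Function.uncurry fun (t' : Fin n → ℝ) (s : ℝ) => Fi (Fin.cons s t')) :=
      (h.measurable.comp continuous_consPair'.measurable).stronglyMeasurable
    exact hsm.integral_prod_right.measurable
  · rw [h.marg_eq_setIntegral, ← Real.norm_eq_abs]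
    exact norm_setIntegral_le_of_norm_le_const measure_Icc_lt_top fun s _ => by
      simpa [Real.norm_eq_abs] using hC _
  · unfold Dhl42.marg
    have : (fun s : ℝ => Fi (Fin.cons s t')) = fun _ => 0 := funext fun s =>
      h.eq_zero _ fun hm => ht' (tail_mem_scaledSimplex_of_cons_mem hm)
    rw [this, integral_zero]

end Marginals

/-! ### §3. Real-valued indicators -/

/-- The indicator of a set as a real number. -/
def ind {α : Type*} (s : Set α) (x : α) : ℝ := s.indicator 1 x

section Ind

variable {α : Type*} {s t : Set α} {x : α}

/-- `ind s x = 1` for `x ∈ s`. -/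
theorem ind_of_mem (h : x ∈ s) : ind s x = 1 := by simp [ind, h]

/-- `ind s x = 0` for `x ∉ s`. -/
theorem ind_of_notMem (h : x ∉ s) : ind s x = 0 := by simp [ind, h]

/-- `ind s x ∈ {0, 1}`. -/
theorem ind_eq_zero_or_one (s : Set α) (x : α) : ind s x = 0 ∨ ind s x = 1 := by
  by_cases h : x ∈ s
  · exact Or.inr (ind_of_mem h)
  · exact Or.inl (ind_of_notMem h)

/-- `0 ≤ ind s x`. -/
theorem ind_nonneg (s : Set α) (x : α) : 0 ≤ ind s x := by
  rcases ind_eq_zero_or_one s x with h | h <;> rw [h]; exact zero_le_one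

/-- `|ind s x| ≤ 1`. -/
theorem abs_ind_le_one (s : Set α) (x : α) : |ind s x| ≤ 1 := by
  rcases ind_eq_zero_or_one s x with h | h <;> simp [h]

/-- `ind s` is a bounded function. -/
theorem bdd_ind (s : Set α) : ∃ C, ∀ x, |ind s x| ≤ C := ⟨1, abs_ind_le_one s⟩

/-- Indicators of the same event agree: `x ∈ s ↔ y ∈ t` gives `ind s x = ind t y`. -/
theorem ind_congr {β : Type*} {t : Set β} {y : β} (h : x ∈ s ↔ y ∈ t) : ind s x = ind t y := by
  by_cases hx : x ∈ s
  · rw [ind_of_mem hx, ind_of_mem (h.1 hx)]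
  · rw [ind_of_notMem hx, ind_of_notMem fun hy => hx (h.2 hy)]

/-- `ind s · ind t = ind (s ∩ t)` pointwise. -/
theorem ind_mul_ind (s t : Set α) (x : α) : ind s x * ind t x = ind (s ∩ t) x := by
  by_cases hs : x ∈ s <;> by_cases ht : x ∈ t <;>
    simp [ind_of_mem, ind_of_notMem, hs, ht, mem_inter_iff]

/-- `ind s` is measurable for measurable `s`. -/
theorem measurable_ind [MeasurableSpace α] (hs : MeasurableSet s) : Measurable (ind s) :=
  measurable_one.indicator hs

/-- `ind s` is Mathlib's `s.indicator 1` (definitional). -/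
theorem ind_eq_indicator (s : Set α) : ind s = s.indicator (1 : α → ℝ) := rfl

/-- `∫ ind s = |s|` (the real measure of a measurable `s`). -/
theorem integral_ind [MeasureSpace α] (hs : MeasurableSet s) : ∫ x, ind s x = volume.real s := by
  simp only [ind_eq_indicator]
  exact integral_indicator_one hs

end Ind

/-- Bounds multiply. -/
theorem bdd_mul {α : Type*} {f g : α → ℝ} (hf : ∃ C, ∀ x, |f x| ≤ C) (hg : ∃ C, ∀ x, |g x| ≤ C) :
    ∃ C, ∀ x, |f x * g x| ≤ C := by
  obtain ⟨C, hC⟩ := hf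
  obtain ⟨D, hD⟩ := hg
  refine ⟨max C 0 * max D 0, fun x => ?_⟩
  rw [abs_mul]
  exact mul_le_mul (le_trans (hC x) (le_max_left _ _)) (le_trans (hD x) (le_max_left _ _))
    (abs_nonneg _) (le_max_right _ _)

/-- The square of a bounded function is bounded. -/
theorem bdd_sq {α : Type*} {f : α → ℝ} (hf : ∃ C, ∀ x, |f x| ≤ C) : ∃ C, ∀ x, |f x ^ 2| ≤ C := by
  simpa only [pow_two] using bdd_mul hf hf

/-- The absolute value of a bounded function is bounded. -/
theorem bdd_abs {α : Type*} {f : α → ℝ} (hf : ∃ C, ∀ x, |f x| ≤ C) : ∃ C, ∀ x, |(|f x|)| ≤ C := by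
  simpa only [abs_abs] using hf

/-- A bounded function composed with any map is bounded. -/
theorem bdd_comp {α β : Type*} {f : β → ℝ} (hf : ∃ C, ∀ x, |f x| ≤ C) (g : α → β) :
    ∃ C, ∀ x, |f (g x)| ≤ C := by
  obtain ⟨C, hC⟩ := hf
  exact ⟨C, fun x => hC _⟩

end

end Summit.Parity.GeneralizedHardyLittlewood.Theorems.Dhl42
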